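import Mathlib
import Literature.Analysis.FluidPDE.BarkerPrangeConcentrationSmallDatum
import HarnessLib.Audit
import HarnessLib

/-!
# Local energy solutions with a small uniformly-local `L²` datum are bounded below the top of a
# short strip (helper for stub 1 of line `pace`, crux `EffSatBlowup`, route `L3TimeExponentPincer`)

Support file for `stmt-NavierStokesRegularity-19139` (`EffSatBlowup`; cell ns-regularity-ideate, seat p4).
It supplies the one PDE input of the registered stub `stub_parabolicConcentration_blowup` (parabolic
`L²` concentration at a blow-up time, Kang–Miura–Tsai 2021 Thm 1.6 (i) = Bradshaw–Tsai 2020), namely the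
small-datum half of Kang–Miura–Tsai's "large data" regularity theorem in its cheapest form:

* `exists_ae_bound_top_of_small_uloc_energy` — there are absolute `γ₁ > 0`, `S ∈ (0, 1]` and `K ≥ 0`
  such that every unit-viscosity local energy solution `(u, p)` on `ℝ³ × (0, S)` (Seregin's class
  `IsLocalEnergySolutionOn S 1 u₀ u p`) whose datum has unit-ball energies `∫_{B(x₀,1)} |u₀|² ≤ γ₁` for
  EVERY centre `x₀` is essentially bounded by `K` on the backward cylinder `Q_{√S/2}(S, 0)` whose vertex
  sits at the TOP of the strip.

This is the `L²_uloc` twin of the tree theorem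
`BarkerPrange2020.exists_eLpNorm_top_parabolicCylinder_lt_top_of_small_L3`
(`Literature/Analysis/FluidPDE/BarkerPrangeConcentrationSmallDatum.lean`), whose proof uses the
`L³`-smallness of the datum ONLY through the unit-ball energies (`≤ 4γ₀²`); here that intermediate bound is
the hypothesis, no rescaling is performed (the strip length is the absolute Jia–Šverák time `ε₀`), and the
conclusion is kept quantitative (the explicit a.e. bound `C₀ ε_r / √ε₀` of the one-scale criterion)
instead of `‖u‖_∞ < ∞`.  The assembly is otherwise verbatim: Jia–Šverák's a priori estimate at unit scale
(`JiaSverak2014.apriori_unit_scale_slab`, `α = 2γ₀²`) bounds unit-ball energies, dissipations and the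
gauged pressure on `(0, ε₀) × B₁(0)` by multiples of `γ₀²`, `γ₀²`, `γ₀³`; interpolation bounds the cubic
integral (`JiaSverak2014.exists_lintegral_cube_window_le_slab`); the gauge is `L^{3/2}` in time
(`BarkerPrange2020.lintegral_gauge_rpow_lt_top`) so the gauged pair is suitable
(`Seregin2014Limit.isSuitableWeakSolutionOn_sub_gauge`); and the unforced one-scale `ε`-regularity
criterion at the vertex `(ε₀, 0)` (`unforced_epsilonRegularity_of_theorem15_3 RRS2016.theorem15_3_holds`,
Robinson–Rodrigo–Sadowski 2016 Thm 15.3) gives `|u| ≤ C₀ ε_r/√ε₀` a.e. on `Q_{√ε₀/2}(ε₀, 0)`.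

Printed counterparts: Kang–Miura–Tsai, Pure Appl. Anal. 3 (2021) = arXiv:2006.13145, Remark 1.2 (3) and
the proof of Thm 1.6 (i) ("if `sup_x ∫_{B₁(x)} |u₀|² ≤ ε_*` then `u` is regular in `ℝ³ × [T/2, T)`");
Jia–Šverák 2013 Lemma 2 / Cor. 1; Lemarié-Rieusset 2002 (local energy a priori estimate).

WHAT THIS IS NOT: not a claim about Navier–Stokes regularity or blow-up; a kernel-checked implication
between tree predicates, landed `--supports` as a helper; no crux is claimed or closed.
-/

noncomputable section

namespace Summit.NavierStokesRegularity.NavierStokesRegularity.Theorems.L3TimeExponentPincerSmallUlocDatumRegularity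

open MeasureTheory Set Function Filter Metric Topology TopologicalSpace
open scoped ENNReal NNReal
open Literature.Analysis.FluidPDE Literature.Analysis.FluidPDE.BarkerPrange2020

/-- **Local energy solutions with a small uniformly-local `L²` datum are bounded below the top of a
short strip.**  There are absolute `γ₁ > 0`, `S ∈ (0, 1]` (the Jia–Šverák time `ε₀`) and `K ≥ 0` such
that: if `(u, p)` is a unit-viscosity local energy solution on `ℝ³ × (0, S)`
(`IsLocalEnergySolutionOn S 1 u₀ u p`) with a measurable datum `u₀` satisfying
`∫_{B(x₀,1)} |u₀|² ≤ γ₁` for every centre `x₀`, then `|u| ≤ K` a.e. on the backward cylinder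
`Q_{√S/2}(S, 0) = (3S/4, S) × B(0, √S/2)`.  Proof: the module docstring (Jia–Šverák's unit-scale a priori
estimate with `α = 2γ₀²`, interpolation, time-integrability of the gauge, and the unforced one-scale
`ε`-regularity criterion of Robinson–Rodrigo–Sadowski's Thm 15.3 at the vertex `(S, 0)`).
[cite: KangMiuraTsai2021PAA, Remark 1.2 (3) and proof of Thm 1.6 (i) (arXiv:2006.13145 pp. 4, 12)]
[cite: JiaSverak2013, Lemma 2 and Cor. 1 (arXiv:1201.1592 pp. 3–4)]
[cite: RobinsonRodrigoSadowski2016, Thm. 15.3] -/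
theorem exists_ae_bound_top_of_small_uloc_energy :
    ∃ γ₁ : ℝ, 0 < γ₁ ∧ ∃ S : ℝ, 0 < S ∧ S ≤ 1 ∧ ∃ K : ℝ, 0 ≤ K ∧
      ∀ (u₀ : EuclideanSpace ℝ (Fin 3) → EuclideanSpace ℝ (Fin 3))
        (u : ℝ → EuclideanSpace ℝ (Fin 3) → EuclideanSpace ℝ (Fin 3))
        (p : ℝ → EuclideanSpace ℝ (Fin 3) → ℝ),
        AEStronglyMeasurable u₀ volume → IsLocalEnergySolutionOn S 1 u₀ u p →
        (∀ x₀ : EuclideanSpace ℝ (Fin 3), ∫⁻ x in ball x₀ 1, ‖u₀ x‖ₑ ^ 2 ≤ ENNReal.ofReal γ₁) →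
        ∀ᵐ w ∂(volume.restrict
            (parabolicCylinder (Real.sqrt S / 2) ((S : ℝ), (0 : EuclideanSpace ℝ (Fin 3))))),
          ‖u w.1 w.2‖ ≤ K := by
  -- ### the absolute constants
  obtain ⟨ε₀, hε₀, hε₀1, C, hAP⟩ := JiaSverak2014.apriori_unit_scale_slab
  obtain ⟨εr, C₀, hεr, hC₀, hREG⟩ :=
    unforced_epsilonRegularity_of_theorem15_3 RRS2016.theorem15_3_holds
  obtain ⟨Kc, hKc⟩ := JiaSverak2014.exists_lintegral_cube_window_le_slab (1 : ℝ)
  have hε₀' : (0 : ℝ) < ε₀ := by exact_mod_cast hε₀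
  have hε₀1' : (ε₀ : ℝ) ≤ 1 := by exact_mod_cast hε₀1
  -- `K' γ³` bounds the cubic plus gauged-pressure integral
  set K' : ℝ := 16 * Kc * C * Real.sqrt C + 2 * Real.sqrt 2 * C with hK'
  have hK'0 : 0 ≤ K' := by rw [hK']; positivity
  set γ₀ : ℝ := min (1 / 2) (εr ^ 3 * ε₀ / (K' + 1)) with hγ₀
  have hγ₀pos : 0 < γ₀ := lt_min (by norm_num) (by positivity)
  have hγ₀half : γ₀ ≤ 1 / 2 := min_le_left _ _
  have hγ₀K : K' * γ₀ ≤ εr ^ 3 * ε₀ := by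
    have h1 : γ₀ ≤ εr ^ 3 * ε₀ / (K' + 1) := min_le_right _ _
    calc K' * γ₀ ≤ (K' + 1) * (εr ^ 3 * ε₀ / (K' + 1)) := by gcongr; linarith
      _ = εr ^ 3 * ε₀ := by field_simp
  -- the one-scale radius `ρ = √ε₀`
  obtain ⟨ρ, hρ_def, hρ, hρ2⟩ : ∃ ρ : ℝ, ρ = Real.sqrt ε₀ ∧ 0 < ρ ∧ ρ ^ 2 = ε₀ :=
    ⟨_, rfl, Real.sqrt_pos.2 hε₀', Real.sq_sqrt hε₀'.le⟩
  have hρ1 : ρ ≤ 1 := by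
    rw [hρ_def, show (1 : ℝ) = Real.sqrt 1 from Real.sqrt_one.symm]
    exact Real.sqrt_le_sqrt hε₀1'
  refine ⟨4 * γ₀ ^ 2, by positivity, ε₀, hε₀', hε₀1', C₀ * εr / ρ, by positivity,
    fun u₀ ut pt hu₀m hsolR hsmall => ?_⟩
  -- ### the datum: unit-ball energies `≤ 4 γ₀² = 2 · (2 γ₀²)`
  set γn : ℝ≥0 := γ₀.toNNReal with hγn
  have hγn_coe : (γn : ℝ) = γ₀ := Real.coe_toNNReal _ hγ₀pos.le
  set α : ℝ≥0 := 2 * γn ^ 2 with hα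
  have hdat : ∀ x₀ : EuclideanSpace ℝ (Fin 3),
      ∫⁻ x in ball x₀ 1, ‖u₀ x‖ₑ ^ 2 ≤ 2 * (α : ℝ≥0∞) := by
    intro x₀
    refine (hsmall x₀).trans (le_of_eq ?_)
    have e1 : (4 * γ₀ ^ 2 : ℝ) = ((2 * (2 * γn ^ 2) : ℝ≥0) : ℝ) := by
      push_cast; rw [hγn_coe]; ring
    rw [e1, ENNReal.ofReal_coe_nnreal, hα]
    push_cast
    ring
  have hγn1 : (γn : ℝ) ≤ 1 / 2 := by rw [hγn_coe]; exact hγ₀half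
  have hα1 : (α : ℝ) ≤ 1 := by
    have h0 : 0 ≤ (γn : ℝ) := γn.coe_nonneg
    have e : (α : ℝ) = 2 * (γn : ℝ) ^ 2 := by rw [hα]; push_cast; ring
    have h1 : (γn : ℝ) ^ 2 ≤ (1 / 2) ^ 2 := pow_le_pow_left₀ h0 hγn1 2
    rw [e]; linarith
  have hTα : (ε₀ : ℝ) * (α : ℝ) ^ 2 ≤ ε₀ := by
    have h0 : 0 ≤ (α : ℝ) := α.coe_nonneg
    have h1 : (α : ℝ) ^ 2 ≤ 1 := pow_le_one₀ h0 hα1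
    calc (ε₀ : ℝ) * (α : ℝ) ^ 2 ≤ ε₀ * 1 := mul_le_mul_of_nonneg_left h1 hε₀'.le
      _ = ε₀ := mul_one _
  -- ### Jia–Šverák's a priori estimate at unit scale on `(0, ε₀)`
  have hsuitR := hsolR.suitable
  obtain ⟨G₁, hG₁, -, -⟩ := hsuitR.localEnergy
  obtain ⟨hE, hD, hP⟩ := hAP u₀ ut pt G₁ α ε₀ ε₀ hu₀m
    hsolR.isLocalLeraySolutionOn hG₁ hdat hε₀' le_rfl le_rfl hTα
  obtain ⟨c, hcm, hcP⟩ := hP 0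
  set Mb : ℝ≥0∞ := 2 * ((C * α : ℝ≥0) : ℝ≥0∞) with hMb
  have hMbtop : Mb ≠ ⊤ := ENNReal.mul_ne_top ENNReal.ofNat_ne_top ENNReal.coe_ne_top
  have hE0 : ∀ᵐ t ∂(volume.restrict (Ioo (0 : ℝ) ε₀)),
      ∫⁻ x in ball (0 : EuclideanSpace ℝ (Fin 3)) 1, ‖ut t x‖ₑ ^ 2 ≤ Mb :=
    hE.mono fun t ht => ht 0
  have hD0 : ∫⁻ z in Ioo (0 : ℝ) ε₀ ×ˢ ball (0 : EuclideanSpace ℝ (Fin 3)) 1,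
      ENNReal.ofReal (frobeniusNormSq (G₁ z.1 z.2)) ≤ Mb :=
    (hD 0).trans (by rw [hMb]; exact le_mul_of_one_le_left bot_le one_le_two)
  -- the cubic integral by interpolation
  have hcube := hKc ut G₁ ε₀ 0 ε₀ 0 Mb le_rfl hε₀'.le le_rfl (by rw [sub_zero]; exact hε₀1') hMbtop
    hG₁ hE0 hD0
  -- ### the gauge is `L^{3/2}` in time; the gauged pair is suitable
  set box : Set (ℝ × EuclideanSpace ℝ (Fin 3)) :=
    Ioo (0 : ℝ) ε₀ ×ˢ ball (0 : EuclideanSpace ℝ (Fin 3)) 1 with hbox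
  have hbox_sub : box ⊆ Ioo (0 : ℝ) ε₀ ×ˢ (univ : Set (EuclideanSpace ℝ (Fin 3))) :=
    prod_mono Subset.rfl (subset_univ _)
  have hum : AEStronglyMeasurable (uncurry ut) (volume.restrict box) :=
    hsolR.aestronglyMeasurable.mono_measure (Measure.restrict_mono hbox_sub le_rfl)
  have hpm : AEStronglyMeasurable (uncurry pt) (volume.restrict box) :=
    hsolR.isLocalLeraySolutionOn.aestronglyMeasurable_pressure.mono_measure
      (Measure.restrict_mono hbox_sub le_rfl)
  have hp1 : ∫⁻ z in box, ‖pt z.1 z.2‖ₑ ^ (3 / 2 : ℝ) < ∞ :=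
    (lintegral_mono_set (Set.prod_mono Subset.rfl ball_subset_closedBall)).trans_lt
      (hsolR.pressure (closedBall 0 1) (isCompact_closedBall 0 1))
  have hp2 : ∫⁻ z in box, ‖pt z.1 z.2 - c z.1‖ₑ ^ (3 / 2 : ℝ) < ∞ :=
    hcP.trans_lt ENNReal.coe_lt_top
  have hcT : ∫⁻ t in Ioo (0 : ℝ) ε₀, ‖c t‖ₑ ^ (3 / 2 : ℝ) < ∞ :=
    lintegral_gauge_rpow_lt_top hcm hpm hp1 hp2
  have hsuit' := Seregin2014Limit.isSuitableWeakSolutionOn_sub_gauge hsuitR hcm hcT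
  obtain ⟨G₂, hG₂, -, hLE₂⟩ := hsuit'.localEnergy
  have hGae := hG₁.ae_eq hG₂
  -- ### the §14.3 hypotheses on the box `(0, ε₀) × B₁(0)`
  set Qbox : Opens (ℝ × EuclideanSpace ℝ (Fin 3)) :=
    ⟨box, isOpen_Ioo.prod isOpen_ball⟩ with hQbox
  have hQcoe : (Qbox : Set (ℝ × EuclideanSpace ℝ (Fin 3))) = box := rfl
  have hQle : Qbox ≤ slab (EuclideanSpace ℝ (Fin 3)) (Ioo 0 ε₀) isOpen_Ioo :=
    fun z hz => mem_slab.2 (show z ∈ box from hz).1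
  have hGbox : ∀ᵐ z ∂(volume.restrict box), uncurry G₁ z = uncurry G₂ z :=
    ae_restrict_of_ae_restrict_of_subset (by rw [coe_slab]; exact hbox_sub) hGae
  have hLR : IsLRSuitableWeakSolutionOn Qbox 1 3 0 ut (fun t x => pt t x - c t) G₂ :=
    { isConnected := by
        rw [hQcoe, hbox]
        exact (isConnected_Ioo hε₀').prod
          ((convex_ball (0 : EuclideanSpace ℝ (Fin 3)) 1).isConnected ⟨0, mem_ball_self one_pos⟩)
      energyClass := by
        refine ⟨2 * (C * α), ?_⟩
        have hE0' := (ae_restrict_iff' (measurableSet_Ioo : MeasurableSet (Ioo (0 : ℝ) ε₀))).1 hE0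
        filter_upwards [hE0'] with t ht
        by_cases htI : t ∈ Ioo (0 : ℝ) ε₀
        · have hfun : (fun x : EuclideanSpace ℝ (Fin 3) => (Qbox : Set (ℝ × EuclideanSpace ℝ (Fin 3))).indicator
              (fun z : ℝ × EuclideanSpace ℝ (Fin 3) => ‖ut z.1 z.2‖ₑ ^ 2) (t, x)) =
              (ball (0 : EuclideanSpace ℝ (Fin 3)) 1).indicator (fun x => ‖ut t x‖ₑ ^ 2) := by
            funext x
            by_cases hx : x ∈ ball (0 : EuclideanSpace ℝ (Fin 3)) 1
            · rw [indicator_of_mem (show (t, x) ∈ (Qbox : Set _) from ⟨htI, hx⟩), indicator_of_mem hx]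
            · rw [indicator_of_notMem (show (t, x) ∉ (Qbox : Set _) from fun h => hx h.2),
                indicator_of_notMem hx]
          rw [hfun, lintegral_indicator measurableSet_ball]
          refine (ht htI).trans (le_of_eq ?_)
          rw [hMb]; push_cast; ring
        · have hfun : (fun x : EuclideanSpace ℝ (Fin 3) => (Qbox : Set (ℝ × EuclideanSpace ℝ (Fin 3))).indicator
              (fun z : ℝ × EuclideanSpace ℝ (Fin 3) => ‖ut z.1 z.2‖ₑ ^ 2) (t, x)) = fun _ => 0 := by
            funext x
            rw [indicator_of_notMem (show (t, x) ∉ (Qbox : Set _) from fun h => htI h.1)]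
          rw [hfun, lintegral_zero]
          exact bot_le
      weakGradient := hG₂.mono hQle
      gradient_lt_top := by
        rw [hQcoe]
        have e : ∫⁻ z in box, ENNReal.ofReal (frobeniusNormSq (G₂ z.1 z.2)) =
            ∫⁻ z in box, ENNReal.ofReal (frobeniusNormSq (G₁ z.1 z.2)) :=
          lintegral_congr_ae (hGbox.mono fun z hz => by
            change ENNReal.ofReal (frobeniusNormSq (uncurry G₂ z)) =
              ENNReal.ofReal (frobeniusNormSq (uncurry G₁ z))
            rw [hz])
        rw [e]
        exact hD0.trans_lt hMbtop.lt_top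
      pressure_lt_top := by rw [hQcoe]; exact hp2
      force_memLp := by rw [uncurry_zero]; exact MemLp.zero
      distributional := hsuit'.distributional.of_le hQle
      localEnergy := fun φ hφ hφ0 => hLE₂ φ (hφ.mono hQle) hφ0 }
  -- ### the one-scale criterion at the vertex `(ε₀, 0)`, radius `ρ = √ε₀`
  set z₀ : ℝ × EuclideanSpace ℝ (Fin 3) := ((ε₀ : ℝ), (0 : EuclideanSpace ℝ (Fin 3))) with hz₀
  have hcyl : parabolicCylinder ρ z₀ ⊆ (Qbox : Set (ℝ × EuclideanSpace ℝ (Fin 3))) := by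
    intro w hw
    rw [mem_parabolicCylinder] at hw
    have h1 : z₀.1 = (ε₀ : ℝ) := rfl
    have h2 : z₀.2 = (0 : EuclideanSpace ℝ (Fin 3)) := rfl
    rw [h1, h2] at hw
    refine ⟨⟨by nlinarith [hw.1.1], hw.1.2⟩, mem_ball.2 (lt_of_lt_of_le hw.2 hρ1)⟩
  -- smallness: cubic `≤ 16 Kc C √C γ₀³`, pressure `≤ 2√2 C γ₀³`, sum `≤ εr³ ρ²`
  have hcubeR : ∫⁻ z in box, ‖ut z.1 z.2‖ₑ ^ (3 : ℕ) ≤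
      ENNReal.ofReal (16 * Kc * C * Real.sqrt C * γ₀ ^ 3) := by
    refine hcube.trans ?_
    have hMbR : Mb = ENNReal.ofReal (4 * C * γ₀ ^ 2) := by
      have h1 : (4 * (C : ℝ) * γ₀ ^ 2) = ((4 * C * γn ^ 2 : ℝ≥0) : ℝ) := by
        push_cast; rw [hγn_coe]
      rw [h1, ENNReal.ofReal_coe_nnreal, hMb, hα]
      push_cast
      ring
    have hx0 : 0 ≤ 4 * (C : ℝ) * γ₀ ^ 2 := by positivity
    have hrp : (4 * (C : ℝ) * γ₀ ^ 2) ^ (3 / 2 : ℝ) = 8 * C * Real.sqrt C * γ₀ ^ 3 := by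
      have hy : 0 ≤ 2 * γ₀ * Real.sqrt C := by positivity
      have e1 : 4 * (C : ℝ) * γ₀ ^ 2 = (2 * γ₀ * Real.sqrt C) ^ 2 := by
        rw [mul_pow, mul_pow, Real.sq_sqrt C.coe_nonneg]; ring
      have e2 : ((2 * γ₀ * Real.sqrt C) ^ 2) ^ (3 / 2 : ℝ) = (2 * γ₀ * Real.sqrt C) ^ (3 : ℕ) := by
        rw [← Real.rpow_natCast _ 2, ← Real.rpow_mul hy, ← Real.rpow_natCast _ 3]
        norm_num
      have e3 : Real.sqrt C ^ 3 = C * Real.sqrt C := by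
        rw [pow_succ, Real.sq_sqrt C.coe_nonneg]
      rw [e1, e2, mul_pow, mul_pow, e3]
      ring
    have hone : ENNReal.ofReal ((ε₀ : ℝ) - 0) ^ (1 / 4 : ℝ) ≤ 1 :=
      ENNReal.rpow_le_one (ENNReal.ofReal_le_one.2 (by linarith)) (by norm_num)
    calc 2 * (Kc : ℝ≥0∞) * Mb ^ (3 / 2 : ℝ) * ENNReal.ofReal ((ε₀ : ℝ) - 0) ^ (1 / 4 : ℝ)
        ≤ 2 * (Kc : ℝ≥0∞) * Mb ^ (3 / 2 : ℝ) * 1 := by gcongr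
      _ = ENNReal.ofReal (16 * Kc * C * Real.sqrt C * γ₀ ^ 3) := by
          rw [mul_one, hMbR, ENNReal.ofReal_rpow_of_nonneg hx0 (by norm_num), hrp,
            ← ENNReal.ofReal_coe_nnreal, ← ENNReal.ofReal_ofNat 2,
            ← ENNReal.ofReal_mul (by norm_num), ← ENNReal.ofReal_mul (by positivity)]
          congr 1; ring
  have hpresR : ∫⁻ z in box, ‖pt z.1 z.2 - c z.1‖ₑ ^ (3 / 2 : ℝ) ≤
      ENNReal.ofReal (2 * Real.sqrt 2 * C * γ₀ ^ 3) := by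
    refine hcP.trans (le_of_eq ?_)
    rw [← ENNReal.ofReal_coe_nnreal]
    congr 1
    rw [hα]
    push_cast
    rw [hγn_coe, Real.sqrt_mul' 2 (sq_nonneg γ₀), Real.sqrt_sq hγ₀pos.le]
    ring
  have hsum : 16 * Kc * C * Real.sqrt C * γ₀ ^ 3 + 2 * Real.sqrt 2 * C * γ₀ ^ 3 ≤ εr ^ 3 * ρ ^ 2 := by
    rw [hρ2]
    have h1 : γ₀ ^ 2 ≤ 1 := pow_le_one₀ hγ₀pos.le (hγ₀half.trans (by norm_num))
    have h3 : γ₀ ^ 3 ≤ γ₀ := by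
      calc γ₀ ^ 3 = γ₀ * γ₀ ^ 2 := by ring
        _ ≤ γ₀ * 1 := mul_le_mul_of_nonneg_left h1 hγ₀pos.le
        _ = γ₀ := mul_one _
    have h4 : 16 * Kc * C * Real.sqrt C * γ₀ ^ 3 + 2 * Real.sqrt 2 * C * γ₀ ^ 3 = K' * γ₀ ^ 3 := by
      rw [hK']; ring
    rw [h4]
    exact (mul_le_mul_of_nonneg_left h3 hK'0).trans hγ₀K
  have humeas : AEMeasurable (fun w : ℝ × EuclideanSpace ℝ (Fin 3) => ‖ut w.1 w.2‖ₑ ^ (3 : ℕ))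
      (volume.restrict box) := hum.aemeasurable.enorm.pow_const _
  have hsmallR : ∫⁻ w in parabolicCylinder ρ z₀,
      (‖ut w.1 w.2‖ₑ ^ (3 : ℕ) + ‖(fun t x => pt t x - c t) w.1 w.2‖ₑ ^ (3 / 2 : ℝ)) ≤
      ENNReal.ofReal (εr ^ 3 * ρ ^ 2) := by
    calc ∫⁻ w in parabolicCylinder ρ z₀,
          (‖ut w.1 w.2‖ₑ ^ (3 : ℕ) + ‖(fun t x => pt t x - c t) w.1 w.2‖ₑ ^ (3 / 2 : ℝ))
        ≤ ∫⁻ w in box, (‖ut w.1 w.2‖ₑ ^ (3 : ℕ) + ‖pt w.1 w.2 - c w.1‖ₑ ^ (3 / 2 : ℝ)) :=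
          lintegral_mono_set hcyl
      _ = (∫⁻ w in box, ‖ut w.1 w.2‖ₑ ^ (3 : ℕ)) + ∫⁻ w in box, ‖pt w.1 w.2 - c w.1‖ₑ ^ (3 / 2 : ℝ) :=
          lintegral_add_left' humeas _
      _ ≤ ENNReal.ofReal (16 * Kc * C * Real.sqrt C * γ₀ ^ 3) +
            ENNReal.ofReal (2 * Real.sqrt 2 * C * γ₀ ^ 3) := add_le_add hcubeR hpresR
      _ = ENNReal.ofReal (16 * Kc * C * Real.sqrt C * γ₀ ^ 3 + 2 * Real.sqrt 2 * C * γ₀ ^ 3) :=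
          (ENNReal.ofReal_add (by positivity) (by positivity)).symm
      _ ≤ ENNReal.ofReal (εr ^ 3 * ρ ^ 2) := ENNReal.ofReal_le_ofReal hsum
  have key := hREG Qbox 3 ut (fun t x => pt t x - c t) G₂ (by norm_num) hLR z₀ ρ εr hρ hcyl hεr.le
    le_rfl hsmallR
  -- ### the conclusion: `Q_{ρ/2}(ε₀, 0)` with `ρ/2 = √ε₀/2`
  have hρhalf : Real.sqrt (ε₀ : ℝ) / 2 = ρ / 2 := by rw [hρ_def]
  rw [hρhalf]
  exact key

end Summit.NavierStokesRegularity.NavierStokesRegularity.Theorems.L3TimeExponentPincerSmallUlocDatumRegularity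

end
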